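import Literature.AlgebraicGeometry.Resolution.KollarMaxContactChartsFieldChange
import Literature.AlgebraicGeometry.Resolution.RegularLocalRingsQuotient
import HarnessLib

/-!
# Chain W5.2 — F5 X-side (c): regular systems of parameters LIFT along a retraction with a Cartier section
# (the ring-level core of the E′-locus half of END-SNC)

[OURS · L1 W5.2 · F5 T5-H, E′-points half; res-L1-w52-plan-1 F5 DESIGN MEMO 06:48:30Z / res-D-pv-009 07:12:56Z
split] Replaces the role of NO printed item; NOT a statement of the manuscript under review; fact-free.

Setting (the stalks at `x = k(y)` of the graded format's data `k : E ⟶ V`, `r : V ⟶ E`, `k ≫ r = 𝟙`): local ring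
homomorphisms `φ : A → B` («`r^#`») and `ψ : B → A` («`k^#`») with `ψ ∘ φ = id`, `ψ` surjective with kernel a
principal ideal `(t)`, `t ≠ 0` («`𝓘_E` effective Cartier»), `A` and `B` regular local. THEN a regular system of
parameters `ū` of `A` lifts to the regular system of parameters `(φ ū, t)` of `B` (`rsop_lift`): `ψ` is local,
`𝔪_B = φ(𝔪_A)B + (t)`, `B/(t) ≅ A` regular so `t ∉ 𝔪_B²` and `emb dim B = emb dim A + 1`. This is what makes simple
normal crossings at a point `y ∈ E′` of the E-side family (the host trace `D′`, the boundary traces `ℬ′`) lift to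
simple normal crossings at `x = k′(y)` of the X-side family (cylinders `r′^*D′`, `r′^*ℬ′` and `E′ = V(t)`) — no
flatness of the retraction is needed AT POINTS OF `E′` (off `E′` the pockets are res-D-pv-009's).

* `ker_le_maximalIdeal`, `mem_maximalIdeal_of_leftInverse`, `map_mem_maximalIdeal_of_leftInverse` — `ψ`, `φ` are local;
* `span_range_snoc_eq_maximalIdeal` — `𝔪_B = (φ ū_1, …, φ ū_d, t)`;
* `spanFinrank_maximalIdeal_eq_succ` — `emb dim B = d + 1`;
* **`rsop_lift`** — both together, in the `Fin (d+1)`-indexed form that `HasSNC`/`HasSNCWith` consume.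

## References
* H. Matsumura, *Commutative Ring Theory* (1986), Thm. 14.2. [Matsumura1987]
* E. Bierstone, D. Grigoriev, P. Milman, J. Włodarczyk, arXiv:1206.3090, Def. 3.1.1, Def. 3.1.3 (2). [BierstoneGrigorievMilmanWlodarczyk2011]
-/

-- `Summit.<Summit>.<Sub>.Theorems` with `Sub = Summit` (single-conjunct summit, D-0017)
set_option linter.dupNamespace false

noncomputable section

open IsLocalRing Literature.AlgebraicGeometry.Resolution

namespace Summit.ResolutionOfSingularities.ResolutionOfSingularities.Theorems

universe u

namespace DepthRetract

variable {A B : Type u} [CommRing A] [CommRing B] [IsLocalRing A] [IsLocalRing B]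
  (φ : A →+* B) (ψ : B →+* A)

/-- The kernel of a surjection between local rings lies in the maximal ideal. [folklore] -/
theorem ker_le_maximalIdeal : RingHom.ker ψ ≤ maximalIdeal B :=
  IsLocalRing.le_maximalIdeal (RingHom.ker_ne_top ψ)

/-- A ring homomorphism between local rings with a right inverse ring homomorphism is local: if `ψ b` is a unit
then `b = φ (ψ b) + (b - φ (ψ b))` with the second summand in `ker ψ ⊆ 𝔪_B`. [folklore] -/
theorem mem_maximalIdeal_of_leftInverse (hψφ : ψ.comp φ = RingHom.id A)
    {b : B} (hb : b ∈ maximalIdeal B) : ψ b ∈ maximalIdeal A := by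
  by_contra hunit
  rw [mem_maximalIdeal, mem_nonunits_iff, not_not] at hunit
  have h1 : IsUnit (φ (ψ b)) := hunit.map φ
  have h2 : b - φ (ψ b) ∈ maximalIdeal B := by
    apply ker_le_maximalIdeal ψ
    rw [RingHom.mem_ker, map_sub, ← RingHom.comp_apply, hψφ, RingHom.id_apply, sub_self]
  have h3 : φ (ψ b) ∈ maximalIdeal B := by
    have : φ (ψ b) = b - (b - φ (ψ b)) := by ring
    rw [this]
    exact (maximalIdeal B).sub_mem hb h2
  exact (mem_nonunits_iff.mp ((mem_maximalIdeal _).mp h3)) h1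

/-- `φ` maps the maximal ideal into the maximal ideal (it has the local left inverse `ψ`). [folklore] -/
theorem map_mem_maximalIdeal_of_leftInverse (hψφ : ψ.comp φ = RingHom.id A) {a : A} (ha : a ∈ maximalIdeal A) :
    φ a ∈ maximalIdeal B := by
  by_contra hunit
  rw [mem_maximalIdeal, mem_nonunits_iff, not_not] at hunit
  have h1 : IsUnit (ψ (φ a)) := hunit.map ψ
  rw [← RingHom.comp_apply, hψφ, RingHom.id_apply] at h1
  exact (mem_nonunits_iff.mp ((mem_maximalIdeal _).mp ha)) h1

/-- **`𝔪_B = φ(𝔪_A)·B + ker ψ`**, in generator form: if `ū` spans `𝔪_A` and `ker ψ = (t)` then `(φ ū, t)` spans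
`𝔪_B`. [cite: Matsumura1987, Thm. 14.2] -/
theorem span_range_snoc_eq_maximalIdeal (hψφ : ψ.comp φ = RingHom.id A)
    {t : B} (hker : RingHom.ker ψ = Ideal.span {t}) {d : ℕ} (u : Fin d → A)
    (hu : Ideal.span (Set.range u) = maximalIdeal A) :
    Ideal.span (Set.range (Fin.snoc (φ ∘ u) t : Fin (d + 1) → B)) = maximalIdeal B := by
  have ht : t ∈ maximalIdeal B :=
    ker_le_maximalIdeal ψ (by rw [hker]; exact Ideal.mem_span_singleton_self t)
  apply le_antisymm
  · rw [Ideal.span_le]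
    rintro _ ⟨j, rfl⟩
    refine Fin.lastCases ?_ (fun i => ?_) j
    · simpa using ht
    · have : (Fin.snoc (φ ∘ u) t : Fin (d + 1) → B) (Fin.castSucc i) = φ (u i) := by simp
      rw [this]
      exact map_mem_maximalIdeal_of_leftInverse φ ψ hψφ (hu ▸ Ideal.subset_span ⟨i, rfl⟩)
  · intro b hb
    have hψb : ψ b ∈ Ideal.span (Set.range u) := by
      rw [hu]; exact mem_maximalIdeal_of_leftInverse φ ψ hψφ hb
    -- `φ (ψ b)` lies in the span of the `φ ū_i`
    have h1 : φ (ψ b) ∈ Ideal.span (Set.range (Fin.snoc (φ ∘ u) t : Fin (d + 1) → B)) := by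
      have hmap : (Ideal.span (Set.range u)).map φ ≤ Ideal.span (Set.range (Fin.snoc (φ ∘ u) t : Fin (d + 1) → B)) := by
        rw [Ideal.map_span, Ideal.span_le]
        rintro _ ⟨_, ⟨i, rfl⟩, rfl⟩
        exact Ideal.subset_span ⟨Fin.castSucc i, by simp⟩
      exact hmap (Ideal.mem_map_of_mem φ hψb)
    -- `b - φ (ψ b) ∈ ker ψ = (t)`
    have h2 : b - φ (ψ b) ∈ Ideal.span (Set.range (Fin.snoc (φ ∘ u) t : Fin (d + 1) → B)) := by
      have hk : b - φ (ψ b) ∈ Ideal.span {t} := by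
        rw [← hker, RingHom.mem_ker, map_sub, ← RingHom.comp_apply, hψφ, RingHom.id_apply, sub_self]
      refine Ideal.span_mono ?_ hk
      rintro _ rfl
      exact ⟨Fin.last d, by simp⟩
    have : b = φ (ψ b) + (b - φ (ψ b)) := by ring
    rw [this]
    exact Ideal.add_mem _ h1 h2

end DepthRetract

namespace DepthRetract

variable {A B : Type u} [CommRing A] [CommRing B] [IsRegularLocalRing A] [IsRegularLocalRing B]
  (φ : A →+* B) (ψ : B →+* A)

/-- **`emb dim B = emb dim A + 1`** when `A`, `B` are regular, `ψ : B → A` is surjective with kernel `(t)`, `t ≠ 0`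
(`B/(t) ≅ A` regular forces `t ∉ 𝔪_B²`, Matsumura 14.2). [cite: Matsumura1987, Thm. 14.2] -/
theorem spanFinrank_maximalIdeal_eq_succ (hψ : Function.Surjective ψ) {t : B} (hker : RingHom.ker ψ = Ideal.span {t}) (ht0 : t ≠ 0) :
    (maximalIdeal B).spanFinrank = (maximalIdeal A).spanFinrank + 1 := by
  have ht : t ∈ maximalIdeal B :=
    ker_le_maximalIdeal ψ (by rw [hker]; exact Ideal.mem_span_singleton_self t)
  -- `B/(t) ≅ A`
  let e : B ⧸ Ideal.span {t} ≃+* A :=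
    (Ideal.quotEquivOfEq hker.symm).trans (RingHom.quotientKerEquivOfSurjective hψ)
  haveI : IsRegularLocalRing (B ⧸ Ideal.span {t}) := IsRegularLocalRing.of_ringEquiv e.symm
  have ht2 : t ∉ maximalIdeal B ^ 2 := notMem_sq_of_isRegularLocalRing_quotient ht ht0
  have h1 := spanFinrank_maximalIdeal_quotient_add_one (R := B) ht ht2
  have h2 : (maximalIdeal (B ⧸ Ideal.span {t})).spanFinrank = (maximalIdeal A).spanFinrank := by
    rw [← IsLocalRing.map_ringEquiv_maximalIdeal e,
      Ideal.spanFinrank_map_eq_of_ringEquiv]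
  omega

/-- [OURS · L1 W5.2] **Regular systems of parameters LIFT along a retraction with a Cartier section.** With
`φ : A → B`, `ψ : B → A`, `ψ ∘ φ = id`, `ψ` surjective with kernel `(t)`, `t ≠ 0`, `A`, `B` regular local: for every
regular system of parameters `ū : Fin d → A` (`d = emb dim A`, `(ū) = 𝔪_A`), `emb dim B = d + 1` and
`(φ ū_1, …, φ ū_d, t)` is a regular system of parameters of `B`. [cite: Matsumura1987, Thm. 14.2]
[cite: BierstoneGrigorievMilmanWlodarczyk2011, Def. 3.1.1] -/
theorem rsop_lift (hψφ : ψ.comp φ = RingHom.id A)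
    (hψ : Function.Surjective ψ) {t : B} (hker : RingHom.ker ψ = Ideal.span {t}) (ht0 : t ≠ 0)
    {d : ℕ} (hd : (maximalIdeal A).spanFinrank = d) (u : Fin d → A)
    (hu : Ideal.span (Set.range u) = maximalIdeal A) :
    (maximalIdeal B).spanFinrank = d + 1 ∧
      Ideal.span (Set.range (Fin.snoc (φ ∘ u) t : Fin (d + 1) → B)) = maximalIdeal B :=
  ⟨by rw [spanFinrank_maximalIdeal_eq_succ ψ hψ hker ht0, hd],
    span_range_snoc_eq_maximalIdeal φ ψ hψφ hker u hu⟩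

end DepthRetract

end Summit.ResolutionOfSingularities.ResolutionOfSingularities.Theorems

end
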